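import Summits.ABC.ABC.Theses.IsogenyGlueCongruence
import Literature.NumberTheory.EllipticCurves.PastenHeightBounds
import Literature.NumberTheory.EllipticCurves.ShafarevichGoodReductionProofs
import Literature.NumberTheory.EllipticCurves.ModularityVersionApProofs
import Literature.NumberTheory.EllipticCurves.ModularCurveNeronLatticeProofs
import Literature.NumberTheory.DiophantineGeometry.FaltingsHeight
import Literature.NumberTheory.DiophantineGeometry.FaltingsHeightJInvariant
import HarnessLib

/-!
# Route `IsogenyGlueCongruence`, support item `SemistableHeightPolyBound` — reduction to
# Pasten's Theorem 1.9

Item `stmt-ABC-13918` of route `ABC/IsogenyGlueCongruence` asks for one absolute constant `c` with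
`h_F(E) ≤ c · N_E²` for every semistable elliptic curve `E/ℚ` given by a global minimal model `W`
(`h_F = WeierstrassCurve.stableFaltingsHeight`, `N_E = W.conductorNorm ℤ`).

This file proves the statement from the single named fact
`Literature.NumberTheory.EllipticCurves.ModularForms.pasten2024_height_lt` (H. Pasten, *Shimura
curves and the abc conjecture*, J. Number Theory 254 (2024), Thm 1.9: for `ε > 0` and
`N ≥ N₀(ε)`, every semistable `E/ℚ` has `h(E) < (1/48 + ε) N log N`), everything else being a
theorem of the tree:

* `h_F(E) ≤ h(E/ℚ)` for a global minimal model (`stableFaltingsHeight_le_faltingsHeight_rat`: the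
  denominator ideal `𝔇` of `j = c₄³/Δ` contains `Δ`, so `N(𝔇) ≤ |Δ_min|`), and
  `h(E/ℚ) = −½ log covol(Λ_Néron) = neronLatticeHeight L`
  (`faltingsHeight_eq_neg_half_log_covolume`, with the Néron lattice supplied by the proved
  uniformisation theorem `exists_isNeronLatticeOf_holds`);
* below the threshold `N₀`: Shafarevich's theorem (`shafarevich_finite_goodReductionOutside_holds`,
  proved in the tree from Siegel's theorem and the unit equation) and `p ∣ N_E ⇔` bad reduction at
  `p` (`dvd_conductorNorm_iff`) leave finitely many `ℚ`-isomorphism classes, on which the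
  isomorphism invariant `h_F` (`stableFaltingsHeight_smul`) is bounded;
* `N log N ≤ N²` and `N ≥ 1`.

The main theorem `semistableHeightPolyBound_of_pasten2024_height_lt` is therefore CONDITIONAL on
`pasten2024_height_lt` (not discharged in the tree: its in-tree reductions stop at Shimura-curve
degree bounds, `PastenHeightBoundsClassicalInputProofs.lean`); it closes the item the moment
`pasten2024_height_lt_holds` lands.

## References

* [PastenShimura2024] H. Pasten, *Shimura curves and the abc conjecture*, J. Number Theory 254
  (2024) 214–335 = arXiv:1705.09251, Thm 1.9 and §3 p. 13.
* [SilvermanAEC2009] J. H. Silverman, *The Arithmetic of Elliptic Curves*, 2nd ed., Thm. IX.6.1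
  (Shafarevich), VIII.8 (global minimal models).
* [Silverman1986] J. H. Silverman, *Heights and elliptic curves*, in Arithmetic Geometry (1986),
  Prop. 1.1 and §2 (the denominator ideal of `j`).
-/

noncomputable section

open scoped Classical

-- `Summit.<Summit>.<Problem>` is the mandated summit-side namespace (CONVENTIONS §2); for the
-- single-conjunct summit `ABC` the two coincide, so the duplicate `ABC.ABC` is deliberate.
set_option linter.dupNamespace false

namespace Summit.ABC.ABC.Theorems

open WeierstrassCurve NumberField IsDedekindDomain
open Literature.NumberTheory.EllipticCurves.ModularForms

/-! ### `h_F(E) ≤ h(E/ℚ)` for a global minimal model -/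

/-- **`N(𝔇) ≤ |Δ_min|`** for a globally minimal model `W/ℚ` of an elliptic curve: the integral
model of `W` over `𝓞 ℚ` has `Δ · j = c₄³ ∈ 𝓞 ℚ`, so `Δ` lies in the denominator ideal `𝔇` of
`j` (`WeierstrassCurve.jDenominatorIdeal`), whence `N(𝔇) ∣ |N(Δ)| = |Δ_min|`
(`minimalDiscriminantNorm_int_eq_natAbs_minimalDiscriminantInt_holds`). This is Silverman's
`𝔇 ∣ Δ_{E/K}` (1986, §2) over `ℚ`. [cite: Silverman1986, §2 (p. 257)] -/
theorem absNorm_jDenominatorIdeal_le_minimalDiscriminantNorm (W : WeierstrassCurve ℚ)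
    [W.IsElliptic] [W.IsGloballyMinimal] :
    Ideal.absNorm W.jDenominatorIdeal ≤ W.minimalDiscriminantNorm ℤ := by
  set a : 𝓞 ℚ := (W.integralModel (𝓞 ℚ)).Δ with ha_def
  have haΔ : (a : ℚ) = W.Δ := integralModel_Δ_eq (𝓞 ℚ) W
  -- `Δ ∈ 𝔇`
  have hmem : a ∈ W.jDenominatorIdeal := by
    rw [mem_jDenominatorIdeal]
    refine ⟨(W.integralModel (𝓞 ℚ)).c₄ ^ 3, ?_⟩
    show algebraMap (𝓞 ℚ) ℚ a * W.j = algebraMap (𝓞 ℚ) ℚ ((W.integralModel (𝓞 ℚ)).c₄ ^ 3)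
    rw [map_pow, integralModel_c₄_eq, ha_def, integralModel_Δ_eq, WeierstrassCurve.j, ← coe_Δ',
      ← mul_assoc, Units.mul_inv, one_mul]
  have hle : Ideal.span {a} ≤ W.jDenominatorIdeal := (Ideal.span_singleton_le_iff_mem _).2 hmem
  have hdvd : Ideal.absNorm W.jDenominatorIdeal ∣ Ideal.absNorm (Ideal.span {a}) :=
    Ideal.absNorm_dvd_absNorm_of_le hle
  rw [Ideal.absNorm_span_singleton] at hdvd
  -- `N(Δ) = Δ_min`
  have hnorm : Algebra.norm ℤ a = minimalDiscriminantInt W := by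
    have h1 : ((Algebra.norm ℤ a : ℤ) : ℚ) = (minimalDiscriminantInt W : ℚ) := by
      have h2 := Algebra.norm_algebraMap (S := ℚ) (a : ℚ)
      rw [Module.finrank_self, pow_one] at h2
      rw [Algebra.coe_norm_int, cast_minimalDiscriminantInt, ← haΔ]
      exact h2
    exact_mod_cast h1
  rw [hnorm] at hdvd
  rw [minimalDiscriminantNorm_int_eq_natAbs_minimalDiscriminantInt_holds W]
  exact Nat.le_of_dvd (Int.natAbs_pos.2 (minimalDiscriminantInt_ne_zero W)) hdvd

/-- **`h_F(E) ≤ h(E/ℚ)`**: for a globally minimal model `W/ℚ` the stable Faltings height is at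
most the Faltings height over `ℚ` — the two closed formulas (`stableFaltingsHeight`,
`faltingsHeight`) differ by `(1/12)(log N(𝔇) − log |Δ_min|) ≤ 0`
(`log_unstableDiscriminant_eq_sub`, `absNorm_jDenominatorIdeal_le_minimalDiscriminantNorm`); for
semistable `E` this is an equality (Silverman 1986, §2: `𝔇 = Δ_{E/K}`), but only the inequality
is needed. [cite: Silverman1986, §2 eq. (9)] -/
theorem stableFaltingsHeight_le_faltingsHeight_rat (W : WeierstrassCurve ℚ) [W.IsElliptic]
    [W.IsGloballyMinimal] : W.stableFaltingsHeight ≤ W.faltingsHeight := by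
  have h := Literature.NumberTheory.DiophantineGeometry.log_unstableDiscriminant_eq_sub W
  have h1 : W.minimalDiscriminantNorm (𝓞 ℚ) = W.minimalDiscriminantNorm ℤ :=
    minimalDiscriminantNorm_ringOfIntegers_rat_holds W
  rw [Module.finrank_self, Nat.cast_one, inv_one, one_mul, h1] at h
  have hD : (0 : ℝ) < Ideal.absNorm W.jDenominatorIdeal := by
    have h0 : Ideal.absNorm W.jDenominatorIdeal ≠ 0 := by
      rw [Ne, Ideal.absNorm_eq_zero_iff]
      exact W.jDenominatorIdeal_ne_bot
    exact_mod_cast Nat.pos_of_ne_zero h0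
  have hle : Real.log (Ideal.absNorm W.jDenominatorIdeal : ℝ) ≤
      Real.log (W.minimalDiscriminantNorm ℤ : ℝ) :=
    Real.log_le_log hD (by exact_mod_cast absNorm_jDenominatorIdeal_le_minimalDiscriminantNorm W)
  linarith

/-- **`h(E/ℚ) = neronLatticeHeight L`**: for a globally minimal `W/ℚ` and a period pair `L`
spanning its Néron lattice, the Faltings height over `ℚ` is `−½ log covol(Λ_L)`
(`faltingsHeight_eq_neg_half_log_covolume`), i.e. the quantity bounded by Pasten's Thm 1.9
as rendered in `PastenHeightBounds.lean`. [cite: PastenShimura2024, §3 (p. 13)] -/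
theorem faltingsHeight_eq_neronLatticeHeight (W : WeierstrassCurve ℚ) [W.IsElliptic]
    [W.IsGloballyMinimal] {L : PeriodPair} (hL : IsNeronLatticeOf (W.baseChange ℂ) L) :
    W.faltingsHeight = neronLatticeHeight L := by
  rw [faltingsHeight_eq_neg_half_log_covolume W hL, neronLatticeHeight]

/-! ### Below the threshold: Shafarevich -/

/-- **Bounded conductor ⇒ bounded stable height.** For every `N₀` there is `B` with
`h_F(E) ≤ B` for every elliptic curve `E/ℚ` of conductor `N_E < N₀`: such a curve has good
reduction at every prime `p ≥ N₀` (`p ∣ N_E ⇔` bad reduction at `p`, `dvd_conductorNorm_iff`), so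
by Shafarevich's theorem (`shafarevich_finite_goodReductionOutside_holds`, Silverman *AEC*
Thm. IX.6.1) it is `ℚ`-isomorphic to one of finitely many Weierstrass models, and `h_F` is an
isomorphism invariant (`stableFaltingsHeight_smul`). [cite: SilvermanAEC2009, Thm. IX.6.1] -/
theorem exists_stableFaltingsHeight_le_of_conductorNorm_lt (N₀ : ℕ) :
    ∃ B : ℝ, ∀ (W : WeierstrassCurve ℚ) [W.IsElliptic], W.conductorNorm ℤ < N₀ →
      W.stableFaltingsHeight ≤ B := by
  -- the finite set of places of residue characteristic `< N₀`
  set f : HeightOneSpectrum (𝓞 ℚ) → ℕ :=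
    fun v => ((Rat.HeightOneSpectrum.primesEquiv v : Nat.Primes) : ℕ) with hf_def
  set S : Set (HeightOneSpectrum (𝓞 ℚ)) := f ⁻¹' Set.Iio N₀ with hS_def
  have hinj : Function.Injective f :=
    Subtype.val_injective.comp (Rat.HeightOneSpectrum.primesEquiv).injective
  have hS : S.Finite := (Set.finite_Iio N₀).preimage hinj.injOn
  obtain ⟨F, hF⟩ := shafarevich_finite_goodReductionOutside_holds ℚ S hS
  -- the bound: the sum of `|h_F|` over the representatives
  set g : WeierstrassCurve ℚ → ℝ :=
    fun V => if hV : V.IsElliptic then |@WeierstrassCurve.stableFaltingsHeight ℚ _ _ V hV| else 0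
    with hg_def
  have hg0 : ∀ V, 0 ≤ g V := by
    intro V
    simp only [hg_def]
    split_ifs
    · exact abs_nonneg _
    · exact le_rfl
  refine ⟨∑ V ∈ F, g V, fun W _ hN => ?_⟩
  have hbad : W.badPlaces (𝓞 ℚ) ⊆ S := by
    intro v hv
    have hv' : ¬ W.HasGoodReductionAt v := hv
    have hdvd : f v ∣ W.conductorNorm ℤ := (W.dvd_conductorNorm_iff v).2 hv'
    have hpos : 0 < W.conductorNorm ℤ := conductorNorm_pos_holds W
    show f v < N₀
    exact lt_of_le_of_lt (Nat.le_of_dvd hpos hdvd) hN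
  obtain ⟨C, hC⟩ := hF W hbad
  have hgC : g (C • W) = |(C • W).stableFaltingsHeight| := by
    simp only [hg_def, dif_pos (inferInstance : (C • W).IsElliptic)]
  calc W.stableFaltingsHeight = (C • W).stableFaltingsHeight := (stableFaltingsHeight_smul W C).symm
    _ ≤ |(C • W).stableFaltingsHeight| := le_abs_self _
    _ = g (C • W) := hgC.symm
    _ ≤ ∑ V ∈ F, g V := Finset.single_le_sum (fun V _ => hg0 V) hC

/-! ### The item, from Pasten's Theorem 1.9 -/

/-- **`SemistableHeightPolyBound` from Pasten 2024, Thm 1.9.** Assuming the named fact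
`pasten2024_height_lt` (Pasten, J. Number Theory 254 (2024), Thm 1.9, unconditional branch),
there is an absolute `c` with `h_F(E) ≤ c · N_E²` for every semistable elliptic `E/ℚ` given by a
global minimal model `W` with `N_E = W.conductorNorm ℤ ≠ 0`. Proof: with `ε = 1`, Thm 1.9
(`pasten2024_height_lt.semistable_crude`) gives `N₀` and `h(E) < (1/48 + 1) N log N ≤ (49/48) N²`
for `N ≥ N₀`, where `h_F(E) ≤ h(E/ℚ) = neronLatticeHeight L` for the Néron lattice `L`
(`stableFaltingsHeight_le_faltingsHeight_rat`, `faltingsHeight_eq_neronLatticeHeight`,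
`exists_isNeronLatticeOf_holds`); for `N < N₀`, `h_F(E) ≤ B`
(`exists_stableFaltingsHeight_le_of_conductorNorm_lt`, Shafarevich); take
`c = max(B, 49/48)` and use `N ≥ 1`. CONDITIONAL on `pasten2024_height_lt` (named fact, not
discharged in the tree). [cite: PastenShimura2024, Thm 1.9] -/
theorem semistableHeightPolyBound_of_pasten2024_height_lt (h : pasten2024_height_lt) :
    Summit.ABC.ABC.Theses.IsogenyGlueCongruence.SemistableHeightPolyBound := by
  unfold Summit.ABC.ABC.Theses.IsogenyGlueCongruence.SemistableHeightPolyBound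
  obtain ⟨N₀, hN₀⟩ := h.semistable_crude one_pos
  obtain ⟨B, hB⟩ := exists_stableFaltingsHeight_le_of_conductorNorm_lt N₀
  refine ⟨max B (1 / 48 + 1), fun W _ _ _ hss => ?_⟩
  have hN1 : (1 : ℝ) ≤ (W.conductorNorm ℤ : ℝ) := by
    exact_mod_cast Nat.one_le_iff_ne_zero.2 (NeZero.ne _)
  have hc0 : (0 : ℝ) ≤ max B (1 / 48 + 1) := le_trans (by norm_num) (le_max_right _ _)
  have hsq : (1 : ℝ) ≤ (W.conductorNorm ℤ : ℝ) ^ 2 := by nlinarith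
  by_cases hN : N₀ ≤ W.conductorNorm ℤ
  · obtain ⟨L, hL⟩ := exists_isNeronLatticeOf_holds (W.baseChange ℂ)
    have hlt := hN₀ W L hL hss hN
    have hlog : Real.log (W.conductorNorm ℤ : ℝ) ≤ (W.conductorNorm ℤ : ℝ) :=
      (Real.log_le_sub_one_of_pos (by linarith)).trans (by linarith)
    have h48 : (0 : ℝ) ≤ (1 / 48 + 1) * (W.conductorNorm ℤ : ℝ) := by positivity
    calc W.stableFaltingsHeight ≤ W.faltingsHeight := stableFaltingsHeight_le_faltingsHeight_rat W
      _ = neronLatticeHeight L := faltingsHeight_eq_neronLatticeHeight W hL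
      _ ≤ (1 / 48 + 1) * (W.conductorNorm ℤ : ℝ) * Real.log (W.conductorNorm ℤ) := hlt.le
      _ ≤ (1 / 48 + 1) * (W.conductorNorm ℤ : ℝ) * (W.conductorNorm ℤ : ℝ) :=
          mul_le_mul_of_nonneg_left hlog h48
      _ = (1 / 48 + 1) * (W.conductorNorm ℤ : ℝ) ^ 2 := by ring
      _ ≤ max B (1 / 48 + 1) * (W.conductorNorm ℤ : ℝ) ^ 2 :=
          mul_le_mul_of_nonneg_right (le_max_right _ _) (by positivity)
  · have hlt : W.conductorNorm ℤ < N₀ := lt_of_not_ge hN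
    calc W.stableFaltingsHeight ≤ B := hB W hlt
      _ ≤ max B (1 / 48 + 1) := le_max_left _ _
      _ = max B (1 / 48 + 1) * 1 := (mul_one _).symm
      _ ≤ max B (1 / 48 + 1) * (W.conductorNorm ℤ : ℝ) ^ 2 := mul_le_mul_of_nonneg_left hsq hc0

end Summit.ABC.ABC.Theorems

end
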